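import Mathlib.Analysis.SpecialFunctions.Complex.Arg
import Mathlib.Analysis.SpecialFunctions.Complex.Log
import Mathlib.Analysis.SpecialFunctions.Pow.Real
import HarnessLib

/-!
# The Maynard–Pratt refined power-sum estimate (Lemma 11 of Maynard–Pratt 2024)

Topic `Literature/Analysis/Complex` (Turán-type power sums; cf. `TuranFirstMainTheorem`,
`TuranSecondMainTheorem`, `BoundedPowerSums` in this directory). ONE named fact and one PROVED
consequence from

* J. Maynard, K. Pratt, *Half-isolated zeros and zero-density estimates*, Int. Math. Res. Not.
  IMRN 2024:19, 12978–13014, doi:10.1093/imrn/rnae191 = arXiv:2206.11729 (`MaynardPratt2024`).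
  Statement numbers and pages below are those of the arXiv text.

## Contents

* `MaynardPratt2024_lemma11` — NAMED FACT: **Lemma 11** (refined power sum estimate, p. 8).
  Under ONE-SIDED conditions — `Im z_r ≥ 0`, `|Re z_r| ≤ 1/(10A)`, near-positivity
  (`|arg c_r| ≤ 1/10`) of the coefficients attached to the `z_r` with `|Im z_r| ≤ (log B)²/A`, a
  distinguished term `(z, c) = (0, 1)`, and `Σ_r |c_r| ≤ B` — the power sum `Σ_r c_r e^{t z_r}` has
  absolute value `≥ B^{-99}` at some REAL `t ∈ [A, 2A]` (polynomially, not exponentially, small in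
  the number of terms, and `t` confined to a dyadic interval: Remark 12).
* `MaynardPratt2024_lemma11.simpleCase` — **Lemma 7** (p. 5, the "simple case" `z_r = iθ_r`,
  `c_r = 1`, bound `(B₀ R)^{-99}`), PROVED from the named fact by the reduction of Remark 12
  (shift by `θ_min`, which changes the sum by a unimodular factor).

## Why a named fact

The printed proof (pp. 9–10) is a contradiction argument: replace each `e^{s x_r}`
(`x_r = Re z_r`) by its Taylor polynomial of degree `⌊3 log B⌋`, apply the Poisson–Jensen
subharmonic inequality on the closed upper half-plane (Lemma 10, p. 8, proved there from Jensen's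
inequality on the disc via the Möbius map `s ↦ iy(1+s)/(1−s) + x` and dominated convergence) to the
resulting entire function `f̃` at the point `iA`, bound `|f̃(iA)| ≥ 1 − O(B^{-200})` from below by
positivity of the real parts of the terms with small `Im z_r`, and bound the Poisson integral of
`log|f̃|` over `ℝ` from above using `|f| ≤ B^{-99}` on `[A, 2A]` and growth bounds elsewhere.
Lemma 10 for functions of growth `exp(O(|z|^{1/2}))` on `ℍ̄` is the piece Mathlib lacks.

## What is NOT here

Lemma 10 (the half-plane subharmonic inequality); Remark 13 (necessity of the conditions, with
Bourgain's example showing the true exponent is `≥ log 4 / log 12 = 0.55…`); the applications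
Lemma 15 and Proposition 16 (short zero-detecting polynomials for half-isolated zeros of `ζ`: see
`Literature/NumberTheory/LFunctions/HalfIsolatedZero.lean`, named fact `MaynardPratt2024_prop16`).
-/

noncomputable section

open Finset

namespace Literature.Analysis.Complex

open _root_.Complex

/-- **Maynard–Pratt 2024, Lemma 11** (refined power sum estimate; p. 8 of arXiv:2206.11729),
NAMED FACT. As printed: let `A, B > 0` with `B` sufficiently large, and let `z₁, …, z_R` and
`c₁, …, c_R` be complex numbers such that
* `z₁ = 0` and `c₁ = 1`;
* `Im(z_r) ≥ 0` for all `1 ≤ r ≤ R`;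
* `|Re(z_r)| ≤ 1/(10A)` for all `1 ≤ r ≤ R`;
* if `|Im(z_r)| ≤ (log B)²/A`, then `|arg(c_r)| ≤ 1/10`;
* `B ≥ Σ_{r=1}^{R} |c_r|`.
Then there is a real `t ∈ [A, 2A]` such that `|Σ_{r=1}^{R} c_r exp(t z_r)| ≥ B^{-99}`.

Lean rendering. The terms are indexed by a finite set `s` in an arbitrary index type, with a
distinguished index `i ∈ s` carrying `(z_i, c_i) = (0, 1)` (the printed `r = 1`). "`B`
sufficiently large" is an absolute threshold `B₀`, uniform in `A`, `R` and the data: the printed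
error terms `O(B^{-2 log log B})`, `O(B^{-200})`, `O(1)` on pp. 9–10 depend on nothing else, and
this uniformity is used in the paper (Lemma 15: `A = log Y` free, `B ≍ log T`). `arg` is
`Complex.arg ∈ (−π, π]`; since `Complex.arg 0 = 0`, a term with `c_r = 0` passes the fourth
condition whatever `z_r` is, but such a term contributes `0` to both sums, so the Lean statement
is the printed one applied to the terms with `c_r ≠ 0` (the distinguished term is among them).
`B > 0` is implied by `B ≥ Σ|c_r| ≥ |c_i| = 1`. [cite: MaynardPratt2024, Lemma 11] -/
def MaynardPratt2024_lemma11 : Prop :=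
  ∃ B₀ : ℝ, ∀ (ι : Type) (s : Finset ι) (z c : ι → ℂ) (A B : ℝ), 0 < A → B₀ ≤ B →
    (∃ i ∈ s, z i = 0 ∧ c i = 1) →
    (∀ r ∈ s, 0 ≤ (z r).im) →
    (∀ r ∈ s, |(z r).re| ≤ 1 / (10 * A)) →
    (∀ r ∈ s, |(z r).im| ≤ Real.log B ^ 2 / A → |(c r).arg| ≤ 1 / 10) →
    ∑ r ∈ s, ‖c r‖ ≤ B →
      ∃ t ∈ Set.Icc A (2 * A), B ^ (-(99 : ℝ)) ≤ ‖∑ r ∈ s, c r * exp ((t : ℂ) * z r)‖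

/-- **Maynard–Pratt 2024, Lemma 7** (simple case of the power sum inequality; p. 5 of
arXiv:2206.11729), PROVED from `MaynardPratt2024_lemma11` by the reduction of Remark 12 (p. 8):
there is an absolute constant `B₀ ≥ 1` such that for real numbers `θ_r` (`r` in a nonempty finite
set `s`, `R = #s`) and every `A > 0` there is a real `t ∈ [A, 2A]` with
`|Σ_r exp(i t θ_r)| ≥ (B₀ R)^{-99}`. (Apply Lemma 11 with `z_r = i(θ_r − θ_min)`, `c_r = 1`,
`B = B₀ R`; the common unimodular factor `exp(−i t θ_min)` does not change the absolute value.)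
[cite: MaynardPratt2024, Lemma 7] -/
theorem MaynardPratt2024_lemma11.simpleCase (h : MaynardPratt2024_lemma11) :
    ∃ B₀ : ℝ, 1 ≤ B₀ ∧ ∀ (ι : Type) (s : Finset ι) (θ : ι → ℝ), s.Nonempty → ∀ A : ℝ, 0 < A →
      ∃ t ∈ Set.Icc A (2 * A),
        (B₀ * s.card) ^ (-(99 : ℝ)) ≤ ‖∑ r ∈ s, exp (I * (t : ℂ) * (θ r : ℂ))‖ := by
  obtain ⟨B₁, hB⟩ := h
  refine ⟨max B₁ 1, le_max_right _ _, fun ι s θ hs A hA ↦ ?_⟩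
  obtain ⟨i₀, hi₀s, hi₀⟩ := s.exists_min_image θ hs
  have hcard : (1 : ℝ) ≤ s.card := by exact_mod_cast hs.card_pos
  have hB₀ : (0 : ℝ) ≤ max B₁ 1 := zero_le_one.trans (le_max_right _ _)
  have hB₁ : B₁ ≤ max B₁ 1 * s.card :=
    calc B₁ ≤ max B₁ 1 := le_max_left _ _
      _ = max B₁ 1 * 1 := (mul_one _).symm
      _ ≤ max B₁ 1 * s.card := mul_le_mul_of_nonneg_left hcard hB₀
  have hsum : ∑ r ∈ s, ‖(fun _ : ι ↦ (1 : ℂ)) r‖ ≤ max B₁ 1 * s.card := by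
    simpa using le_mul_of_one_le_left (Nat.cast_nonneg s.card) (le_max_right B₁ 1)
  obtain ⟨t, ht, hbound⟩ := hB ι s (fun r ↦ I * ((θ r - θ i₀ : ℝ) : ℂ)) (fun _ ↦ 1) A
    (max B₁ 1 * s.card) hA hB₁ ⟨i₀, hi₀s, by simp, rfl⟩
    (fun r hr ↦ by simpa using hi₀ r hr)
    (fun r _ ↦ by simp; positivity)
    (fun r _ _ ↦ by simp)
    hsum
  refine ⟨t, ht, hbound.trans_eq ?_⟩
  -- remove the unimodular factor `exp(−i t θ_min)`
  have key : ∑ r ∈ s, (fun _ : ι ↦ (1 : ℂ)) r * exp ((t : ℂ) * (I * ((θ r - θ i₀ : ℝ) : ℂ))) =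
      (∑ r ∈ s, exp (I * (t : ℂ) * (θ r : ℂ))) * exp (-(I * (t : ℂ) * (θ i₀ : ℂ))) := by
    rw [Finset.sum_mul]
    refine Finset.sum_congr rfl fun r _ ↦ ?_
    rw [one_mul, ← Complex.exp_add]
    congr 1
    push_cast
    ring
  rw [key, norm_mul, Complex.norm_exp]
  simp

end Literature.Analysis.Complex
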